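import Summits.KontsevichZagierPeriods.KontsevichZagierPeriods.Theses.IsogenyCertificates
import Summits.KontsevichZagierPeriods.KontsevichZagierPeriods.Theorems.IsogenyCertificatesXMapKernelCellsUnconditional
import Summits.KontsevichZagierPeriods.KontsevichZagierPeriods.Theorems.IsogenyCertificatesXMapKernelIffSummit
import Literature.NumberTheory.Transcendental.KZRelationsLE
import Literature.NumberTheory.Transcendental.ManyCurvePeriods
import Literature.NumberTheory.Transcendental.AnalyticSubgroupElliptic

/-!
# Skeleton — forward rung `EllipticLogCell` under the crux `XMapKernel` (stmt-KontsevichZagierPeriods-10663)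

Line `EllipticLogCell` (rung harvest, unit `fwd-harvest-KontsevichZagierPeriods-10663`, 2026-08-17; the rung was
typed, witnessed, probed and skeletonised by the G4 ladder-down seat `fwd-ladder-KontsevichZagierPeriods-10663`
(its `Sketch.lean`, `bc/EllipticLogCell_birth.lean`, `bc/EllipticLogCell_special.lean`, `LADDER-XMapKernel.md` §3–§5),
which could not `crux write` at the time; this file assembles those checked pieces verbatim — nothing re-invented).

* rung_decl    = `Summit.KontsevichZagierPeriods.KontsevichZagierPeriods.Cruxes.XMapKernel.EllipticLogCell.EllipticLogCell`
* witness      = `Summit.KontsevichZagierPeriods.IsogenyCertificates.XMapKernelCells.realPeriodCellKernel_relations`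
                 (the real-period cell of route IsogenyCertificates, unconditional) — `rung_floor` below and
                 `Lines/EllipticLogCell_special.lean`
* crux         = `Summit.KontsevichZagierPeriods.KontsevichZagierPeriods.Theses.IsogenyCertificates.XMapKernel`, certified
                 summit-equivalent (`XMapKernelIffSummit.xMapKernel_iff_summit`); this line does NOT attack it head-on
                 (three registered lines died at the remainder `K ↔ S`, STRATEGY-CENSUS r1); its CONTENT is the rung.

## The rung

The graded family `IncompleteRealPeriodCell W` = Conjecture 1 in kernel form on the sector of INCOMPLETE real elliptic
integrals of the first kind `a·∫_{w ∩ {P>0}} dx/√P` (`P = x³+Ax+B`, `(A,B) ∈ ℤ²` nonsingular, `a ∈ ℚ`, windows `w ∈ W`):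
`W = wholeWindow = {univ}` is the FLOOR (PROVED: the real-period cell), `W = ratWindows` (open windows with endpoints in
`ℚ ∪ {±∞}`) is THE RUNG `EllipticLogCell` — all `ℤ`-linear relations among real elliptic logarithms of the points with
rational abscissa on all elliptic curves over `ℚ` (and the real periods) are chains of the KZ moves. One move above the
floor: the DOMAIN CLASS of the generators (whole positivity set → rational sub-window).

## The line (3 rung stubs; `EllipticLogCell_of` is a real proof)

* `stub_ellipticLogLinearForms` (T, XL) — linear forms in elliptic logarithms on several pairwise non-isogenous curves,
  CM allowed, in `EndMul`-span form (refined analytic subgroup theorem for `𝔾ₐ × Πᵢ Eᵢⁿ`; the one-curve non-CM hyperplane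
  form is the tree THEOREM `analyticSubgroupTheorem_GaGmE_holds`).
* `stub_chordMove` (G, M) — THE NEW MOVE: Euler's addition theorem for incomplete first-kind integrals as a KZ chain
  (translation by an algebraic point = rule 2 along an algebraic map, piecewise), in disjunctive ray form.
* `stub_reduction` (R, L) — the port of the floor's engine: ray normal form, chord/torsion bookkeeping, piecewise isogeny
  x-map transfer, closing by T.

## Ladder to the top (typed by the source seat; FLAGGED ladder steps, NOT work targets of this line)

`EllipticLogCell → DimOneKernel` (`stub_headStep`: the rest of dimension one — the method family's ceiling) and the
dimension steps `∀ d ≥ 1, GradedStep d` (`stub_dimensionSteps`: beyond the ceiling, owned by the dimension routes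
AbelContraction 14403 / DessinsDimensionOne 18965 / 4280) compose to the crux BY NAME through the PROVED descent
`kzKernel_of_ladder` and the landed `XMapKernelIffSummit.xMapKernel_iff_kzKernelConjecture` (`XMapKernel_of`). They are
registered only so that the skeleton concludes the crux by name; each is strictly below `S` on its own; jointly with the
rung they are `S` (declared openly — this is the ladder, LADDER-XMapKernel.md §5, not a claim of a route).

`sorry` occurs ONLY inside the five `stub_*`; `EllipticLogCell_of`, `kzKernel_of_ladder`, `XMapKernel_of` are real proofs.
-/

noncomputable section

namespace Summit.KontsevichZagierPeriods.KontsevichZagierPeriods.Cruxes.XMapKernel.EllipticLogCell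

set_option linter.dupNamespace false

open Literature.NumberTheory.Transcendental
open Summit.KontsevichZagierPeriods.KontsevichZagierPeriods.Theses.IsogenyCertificates
open Summit.KontsevichZagierPeriods.XMapKernel.Negative
open Summit.KontsevichZagierPeriods.IsogenyCertificates
open scoped BigOperators
open Set

/-! ## §1 The rung (definitions verbatim from the source seat's `Sketch.lean`) -/

/-- Generators of the incomplete real-period sector with windows from `W`: representations
`[w ∩ {x³+Ax+B > 0}, a/√(x³+Ax+B)]`, `(A,B) ∈ ℤ²` nonsingular, `a ∈ ℚ`, `w ∈ W`. -/
def incompleteGens (W : Set (Set ℝ)) : Set KZ.FormalRep :=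
  {d | ∃ (A B : ℤ) (a : ℚ) (w : Set ℝ) (r : KZ.IntegralRep 1), 4 * A ^ 3 + 27 * B ^ 2 ≠ 0 ∧ w ∈ W ∧
    r.domain = {x | x 0 ∈ w ∧ 0 < x 0 ^ 3 + (A : ℝ) * x 0 + (B : ℝ)} ∧
    Set.EqOn r.integrand (fun x => (a : ℝ) / Real.sqrt (x 0 ^ 3 + (A : ℝ) * x 0 + (B : ℝ))) r.domain ∧
    d = KZ.of r}

/-- **The rung family `θ = W`**: Conjecture 1 in kernel form on the incomplete real-period sector with windows
from `W` — every value-`0` formal `ℤ`-combination of its generators is a relation of the four-move KZ calculus. -/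
def IncompleteRealPeriodCell (W : Set (Set ℝ)) : Prop :=
  ∀ c ∈ AddSubgroup.closure (incompleteGens W), KZ.eval c = 0 → c ∈ KZ.relations

/-- `θ₀`: only the whole line as window (complete real periods) — the FLOOR. -/
def wholeWindow : Set (Set ℝ) := {Set.univ}

/-- `θ₁`: open windows with endpoints in `ℚ ∪ {±∞}`. -/
def ratWindows : Set (Set ℝ) :=
  {w | ∃ p q : ℚ, w = Set.Ioo (p : ℝ) (q : ℝ)} ∪ {w | ∃ p : ℚ, w = Set.Ioi (p : ℝ)} ∪
    {w | ∃ q : ℚ, w = Set.Iio (q : ℝ)} ∪ {Set.univ}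

/-- `θ₂`: open windows with real-algebraic endpoints (or `±∞`) — the rung after this one. -/
def algWindows : Set (Set ℝ) :=
  {w | ∃ p q : ℝ, IsAlgebraic ℚ p ∧ IsAlgebraic ℚ q ∧ w = Set.Ioo p q} ∪ {w | ∃ p : ℝ, IsAlgebraic ℚ p ∧ w = Set.Ioi p} ∪
    {w | ∃ q : ℝ, IsAlgebraic ℚ q ∧ w = Set.Iio q} ∪ {Set.univ}

/-- **THE RUNG** — the elliptic-logarithm cell: Conjecture 1 in kernel form on incomplete real elliptic integrals of
the first kind with rational endpoints, across all elliptic curves over `ℚ` in short integral Weierstrass form. -/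
def EllipticLogCell : Prop := IncompleteRealPeriodCell ratWindows

/-- The rung after it: real-algebraic endpoints. -/
def AlgWindowCell : Prop := IncompleteRealPeriodCell algWindows

/-! ## §2 Monotonicity, the PROVED floor (F3), on-path theorems (F4) -/

theorem incompleteGens_mono {W W' : Set (Set ℝ)} (h : W ⊆ W') : incompleteGens W ⊆ incompleteGens W' := by
  rintro d ⟨A, B, a, w, r, hΔ, hw, hdom, hint, rfl⟩
  exact ⟨A, B, a, w, r, hΔ, h hw, hdom, hint, rfl⟩

/-- Larger window classes give stronger rungs (the family is antitone in `W`). -/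
theorem IncompleteRealPeriodCell.anti {W W' : Set (Set ℝ)} (h : W ⊆ W') :
    IncompleteRealPeriodCell W' → IncompleteRealPeriodCell W := fun H c hc h0 =>
  H c (AddSubgroup.closure_mono (incompleteGens_mono h) hc) h0

theorem wholeWindow_subset_ratWindows : wholeWindow ⊆ ratWindows := by
  intro w hw
  rw [wholeWindow, Set.mem_singleton_iff] at hw
  subst hw
  exact Or.inr rfl

theorem ratWindows_subset_algWindows : ratWindows ⊆ algWindows := by
  rintro w (((⟨p, q, rfl⟩ | ⟨p, rfl⟩) | ⟨q, rfl⟩) | hw)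
  · exact Or.inl (Or.inl (Or.inl ⟨p, q, isAlgebraic_algebraMap (p : ℚ), isAlgebraic_algebraMap (q : ℚ), rfl⟩))
  · exact Or.inl (Or.inl (Or.inr ⟨p, isAlgebraic_algebraMap (p : ℚ), rfl⟩))
  · exact Or.inl (Or.inr ⟨q, isAlgebraic_algebraMap (q : ℚ), rfl⟩)
  · exact Or.inr hw

/-- rung ⇒ floor (the next rung contains the floor's sector). -/
theorem floorCell_of_ellipticLogCell (h : EllipticLogCell) : IncompleteRealPeriodCell wholeWindow :=
  IncompleteRealPeriodCell.anti wholeWindow_subset_ratWindows h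

/-- next-next rung ⇒ next rung. -/
theorem ellipticLogCell_of_algWindowCell (h : AlgWindowCell) : EllipticLogCell :=
  IncompleteRealPeriodCell.anti ratWindows_subset_algWindows h

/-- The `θ₀` generators are literally the real-period cell's generators. -/
theorem incompleteGens_wholeWindow :
    incompleteGens wholeWindow =
      {d : KZ.FormalRep | ∃ (A B : ℤ) (a : ℚ) (r : KZ.IntegralRep 1), 4 * A ^ 3 + 27 * B ^ 2 ≠ 0 ∧
        r.domain = {x | 0 < x 0 ^ 3 + (A : ℝ) * x 0 + (B : ℝ)} ∧
        Set.EqOn r.integrand (fun x => (a : ℝ) / Real.sqrt (x 0 ^ 3 + (A : ℝ) * x 0 + (B : ℝ))) r.domain ∧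
        d = KZ.of r} := by
  ext d
  simp only [incompleteGens, wholeWindow, Set.mem_setOf_eq, Set.mem_singleton_iff]
  constructor
  · rintro ⟨A, B, a, w, r, hΔ, rfl, hdom, hint, rfl⟩
    refine ⟨A, B, a, r, hΔ, ?_, hint, rfl⟩
    rw [hdom]; ext x; simp
  · rintro ⟨A, B, a, r, hΔ, hdom, hint, rfl⟩
    refine ⟨A, B, a, Set.univ, r, hΔ, rfl, ?_, hint, rfl⟩
    rw [hdom]; ext x; simp

/-- **F3 WITNESS (floor `θ₀`, PROVED).** The floor rung is the tree theorem
`XMapKernelCells.realPeriodCellKernel_relations` (real-period cell of route IsogenyCertificates, unconditional since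
`HuberWustholzManyCurvePeriods_holds`). See also `Lines/EllipticLogCell_special.lean`. -/
theorem rung_floor : IncompleteRealPeriodCell wholeWindow := by
  intro c hc h0
  rw [incompleteGens_wholeWindow] at hc
  exact XMapKernelCells.realPeriodCellKernel_relations c hc h0

/-- Kernel form of the summit (tree: `summit_iff_kzKernelConjecture`). -/
theorem kernel_of_summit (hS : _root_.KontsevichZagierPeriods) (c : KZ.FormalRep) (h0 : KZ.eval c = 0) :
    c ∈ KZ.relations :=
  (summit_iff_kzKernelConjecture.1 hS) c h0

/-- On-path (summit form): `S → Rung W` for every window class; in particular `S → EllipticLogCell` (the rung is a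
consequence of `S`; the `[nec]`-trap is discharged by the F3 pin `rung_floor`). -/
theorem rung_of_summit (hS : _root_.KontsevichZagierPeriods) (W : Set (Set ℝ)) : IncompleteRealPeriodCell W :=
  fun c _ h0 => kernel_of_summit hS c h0

theorem ellipticLogCell_of_summit (hS : _root_.KontsevichZagierPeriods) : EllipticLogCell := rung_of_summit hS _

/-- On-path (crux form): `XMapKernel → EllipticLogCell`. -/
theorem ellipticLogCell_of_xMapKernel (h : XMapKernel) : EllipticLogCell :=
  fun c _ h0 => (XMapKernelIffSummit.xMapKernel_iff_kzKernelConjecture.mp h) c h0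

/-! ## §3 Stub statements (named; verbatim from the source seat's `bc/EllipticLogCell_birth.lean`) -/

/-- The multiplier ring of a lattice: `End(Λ) = {a ∈ ℂ : aΛ ⊆ Λ}` (`ℤ` without CM, an order in an imaginary
quadratic field with CM). -/
def EndMul (L : PeriodPair) : Set ℂ := {a : ℂ | ∀ w ∈ L.lattice, a * w ∈ L.lattice}

/-- **Linear forms in elliptic logarithms, several curves, CM allowed** (refined analytic subgroup theorem for
`𝔾ₐ × Πᵢ Eᵢⁿ`): for pairwise non-isogenous lattices `Λᵢ` with algebraic invariants and `zᵢⱼ` exponentiating to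
`ℚ̄`-points of `Eᵢ` (a lattice vector, or `℘_{Λᵢ}(zᵢⱼ) ∈ ℚ̄`), a relation `α + Σᵢⱼ cᵢⱼ zᵢⱼ = 0` with algebraic
`α, cᵢⱼ` has `α = 0`, and for each `i` the row `(cᵢⱼ)ⱼ` is a `ℚ̄`-linear combination of rows `ρ` with entries in
`End(Λᵢ)` satisfying the EXACT relation `Σⱼ ρⱼ zᵢⱼ = 0`. -/
def EllipticLogLinearForms : Prop :=
  ∀ (k n : ℕ) (L : Fin k → PeriodPair) (z : Fin k → Fin n → ℂ),
    (∀ i, IsAlgebraic ℚ (L i).g₂ ∧ IsAlgebraic ℚ (L i).g₃) →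
    (∀ i j, i ≠ j → ¬ (L i).IsIsogenousTo (L j)) →
    (∀ i j, z i j ∈ (L i).lattice ∨ (z i j ∉ (L i).lattice ∧ IsAlgebraic ℚ ((L i).weierstrassP (z i j)))) →
    ∀ (α : ℂ) (c : Fin k → Fin n → ℂ), IsAlgebraic ℚ α → (∀ i j, IsAlgebraic ℚ (c i j)) →
      α + ∑ i, ∑ j, c i j * z i j = 0 →
        α = 0 ∧ ∀ i, ∃ (s : ℕ) (ρ : Fin s → Fin n → ℂ) (μ : Fin s → ℂ),
          (∀ t j, ρ t j ∈ EndMul (L i)) ∧ (∀ t, ∑ j, ρ t j * z i j = 0) ∧ (∀ t, IsAlgebraic ℚ (μ t)) ∧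
          ∀ j, c i j = ∑ t, μ t * ρ t j

/-- **The chord move** (Euler's addition theorem for incomplete elliptic integrals of the first kind as a KZ chain):
for a nonsingular integral cubic `P = x³+Ax+B`, abscissae `p₁ ≠ p₂` with `P > 0` on `[pᵢ, ∞)` (both on the unbounded
component), `yᵢ = √P(pᵢ)`, `λ = (y₂−y₁)/(p₂−p₁)`, `p₃ = λ²−p₁−p₂` (abscissa of the chord's third point, again on the
unbounded component), the rays `rᵢ = [{x > pᵢ, P > 0}, 1/√P]` and the component `r₀ = [{P>0, P>0 beyond}, 1/√P]`
satisfy `[r₃] − [r₁] − [r₂] ∈ KZ.relations` or `[r₃] + [r₁] + [r₂] − 2·[r₀] ∈ KZ.relations` (the sign of the third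
point's ordinate decides which). -/
def ChordMove : Prop :=
  ∀ (A B : ℤ) (p₁ p₂ : ℝ), 4 * A ^ 3 + 27 * B ^ 2 ≠ 0 → p₁ ≠ p₂ →
    (∀ t : ℝ, p₁ ≤ t → 0 < t ^ 3 + (A : ℝ) * t + (B : ℝ)) → (∀ t : ℝ, p₂ ≤ t → 0 < t ^ 3 + (A : ℝ) * t + (B : ℝ)) →
    ∀ (r₀ r₁ r₂ r₃ : KZ.IntegralRep 1),
      r₀.domain = {x | 0 < x 0 ^ 3 + (A : ℝ) * x 0 + (B : ℝ) ∧ ∀ t : ℝ, x 0 < t → 0 < t ^ 3 + (A : ℝ) * t + (B : ℝ)} →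
      r₁.domain = {x | p₁ < x 0 ∧ 0 < x 0 ^ 3 + (A : ℝ) * x 0 + (B : ℝ)} →
      r₂.domain = {x | p₂ < x 0 ∧ 0 < x 0 ^ 3 + (A : ℝ) * x 0 + (B : ℝ)} →
      r₃.domain = {x | ((Real.sqrt (p₂ ^ 3 + (A : ℝ) * p₂ + (B : ℝ)) - Real.sqrt (p₁ ^ 3 + (A : ℝ) * p₁ + (B : ℝ))) /
          (p₂ - p₁)) ^ 2 - p₁ - p₂ < x 0 ∧ 0 < x 0 ^ 3 + (A : ℝ) * x 0 + (B : ℝ)} →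
      (∀ i : Fin 4, Set.EqOn (![r₀, r₁, r₂, r₃] i).integrand
          (fun x => 1 / Real.sqrt (x 0 ^ 3 + (A : ℝ) * x 0 + (B : ℝ))) (![r₀, r₁, r₂, r₃] i).domain) →
      KZ.of r₃ - KZ.of r₁ - KZ.of r₂ ∈ KZ.relations ∨
        KZ.of r₃ + KZ.of r₁ + KZ.of r₂ - 2 • KZ.of r₀ ∈ KZ.relations

/-- Statement of `stub_reduction`: the two inputs give the rung. -/
def Reduction : Prop := EllipticLogLinearForms → ChordMove → EllipticLogCell

/-! ## §4 Registered RUNG stubs (the work targets of this line) -/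

/-- **Stub T (XL) — transcendence input** (literature debt beyond one non-CM curve; the one-curve non-CM hyperplane
form is the tree theorem `analyticSubgroupTheorem_GaGmE_holds`, the span form follows by Smith normal form on
`ℤ`-relations; several curves / CM with points: port along the `ManyCurveStd*` template).
[cite: Wustholz1989] [cite: BakerWustholz2007, Thm. 6.2] [cite: HuberWustholz2022, Thm. 6.2, Thm. 15.3] -/
theorem stub_ellipticLogLinearForms : EllipticLogLinearForms := by
  sorry

/-- **Stub G (M) — the chord move** (translation by an algebraic point as rule 2, on ≤ 3 monotone pieces + domain
additivity; numerically checked by the source seat on 7 configurations to 2·10⁻⁷, exactly one disjunct each time).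
[cite: KontsevichZagier2001, §1.2 rule (2)] [cite: SilvermanAEC2009, III.2 (group law), III.5 (invariant differential)] -/
theorem stub_chordMove : ChordMove := by
  sorry

/-- **Stub R (L) — the reduction**: ray normal form (windows = differences of rays, rule 1a) + chord/torsion
bookkeeping to a `ℤ`-basis of the occurring points per curve + piecewise isogeny x-map transfer across a class (port
of `XMapPeriodTransferCells.*` / `EffectiveXMapChainsStubPieceCoV` to sub-intervals) + closing by
`EllipticLogLinearForms` (zero coefficients ⇒ zero integrands ⇒ relations).
[cite: KontsevichZagier2001, §1.2] [cite: HuberWustholz2022, Thm. 15.3] -/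
theorem stub_reduction : Reduction := by
  sorry

/-! ## §5 The composition (real proof) -/

/-- **Composition** (kernel-checked): the three rung stubs give the rung. -/
theorem EllipticLogCell_of : EllipticLogLinearForms → ChordMove → Reduction → EllipticLogCell :=
  fun hT hG hR => hR hT hG

/-- The rung itself, from its three stubs (closed form). -/
theorem ellipticLogCell_of_stubs : EllipticLogCell :=
  EllipticLogCell_of stub_ellipticLogLinearForms stub_chordMove stub_reduction

/-! ## §6 Ladder to the top (typed by the source seat, `Sketch.lean` §5): dimension one, the dimension steps, the crux

FLAGGED: `stub_headStep` and `stub_dimensionSteps` are LADDER STEPS (gap_after of LADDER-XMapKernel.md), registered only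
so that `XMapKernel_of` concludes the crux by name — NOT work targets of this line; each is strictly below `S` alone,
jointly with the rung they are `S` (ladder, stated openly). -/

/-- HeadCell 1: the dimension-one kernel conjecture (every value-0 combination of representations of dimension ≤ 1 is a
relation; the weaker kernel reading of SymplecticScissors' `RealOnePeriodRelations` 10042; the ceiling of the
analytic-subgroup-theorem family). -/
def DimOneKernel : Prop := ∀ c ∈ KZ.formalRepLE 1, KZ.eval c = 0 → c ∈ KZ.relations

/-- Every incomplete generator is a 1-dimensional representation. -/
theorem incompleteGens_subset_formalRepLE (W : Set (Set ℝ)) :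
    incompleteGens W ⊆ (KZ.formalRepLE 1 : Set KZ.FormalRep) := by
  rintro d ⟨A, B, a, w, r, -, -, -, -, rfl⟩
  exact KZ.of_mem_formalRepLE r le_rfl

/-- HeadCell 1 ⇒ every rung of the family (the family sits inside dimension one). -/
theorem rung_of_dimOneKernel (h : DimOneKernel) (W : Set (Set ℝ)) : IncompleteRealPeriodCell W := fun c hc h0 =>
  h c ((AddSubgroup.closure_le _).2 (incompleteGens_subset_formalRepLE W) hc) h0

/-- The dimension step `d+1 → d`: value-0 combinations of dimension ≤ d+1 reduce modulo the rules to dimension ≤ d. -/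
def GradedStep (d : ℕ) : Prop :=
  ∀ c ∈ KZ.formalRepLE (d + 1), KZ.eval c = 0 → ∃ c' ∈ KZ.formalRepLE d, c - c' ∈ KZ.relations

/-- Statement of the flagged ladder step 1: from the rung to all of dimension one. -/
def HeadStep : Prop := EllipticLogCell → DimOneKernel

/-- Statement of the flagged ladder step 2: all dimension steps `d ≥ 1` (the dimension tail; owned by the dimension
routes: AbelContraction `ReductionToDimensionOne` 14403, DessinsDimensionOne `DimensionStep` 18965 / `KZDimTwo` 4280). -/
def DimensionSteps : Prop := ∀ d, 1 ≤ d → GradedStep d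

/-- Descent along the steps: from dimension `1 + k` down to dimension `1` (PROVED). -/
theorem descend (hstep : DimensionSteps) :
    ∀ k : ℕ, ∀ c ∈ KZ.formalRepLE (1 + k), KZ.eval c = 0 → ∃ c' ∈ KZ.formalRepLE 1, c - c' ∈ KZ.relations := by
  intro k
  induction k with
  | zero => intro c hc _; exact ⟨c, by simpa using hc, by simp [KZ.relations.zero_mem]⟩
  | succ k ih =>
    intro c hc h0
    have hc' : c ∈ KZ.formalRepLE ((1 + k) + 1) := by simpa [Nat.add_assoc] using hc
    obtain ⟨c₁, hc₁, hrel⟩ := hstep (1 + k) (Nat.le_add_right 1 k) c hc' h0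
    have h01 : KZ.eval c₁ = 0 := by
      have hr : KZ.eval (c - c₁) = 0 := KZ.relations_le_ker_eval_holds hrel
      rw [map_sub, h0, zero_sub, neg_eq_zero] at hr
      exact hr
    obtain ⟨c₂, hc₂, hrel₂⟩ := ih c₁ hc₁ h01
    refine ⟨c₂, hc₂, ?_⟩
    have : c - c₂ = (c - c₁) + (c₁ - c₂) := by abel
    rw [this]
    exact KZ.relations.add_mem hrel hrel₂

/-- **The ladder reaches the kernel conjecture** (PROVED): HeadCell 1 and the dimension steps `d ≥ 1` give
`KZKernelConjecture` (every `c` has a dimension; descend to dimension one; apply the head cell). -/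
theorem kzKernel_of_ladder (hhead : DimOneKernel) (hstep : DimensionSteps) : KZKernelConjecture := by
  intro c h0
  obtain ⟨D, hD⟩ : ∃ D, c ∈ KZ.formalRepLE D := by
    have h := KZ.mem_iSup_formalRepLE c
    exact (AddSubgroup.mem_iSup_of_directed (fun i j => ⟨max i j, KZ.formalRepLE_mono (le_max_left i j),
      KZ.formalRepLE_mono (le_max_right i j)⟩)).1 h
  have hD' : c ∈ KZ.formalRepLE (1 + D) := KZ.formalRepLE_mono (Nat.le_add_left D 1) hD
  obtain ⟨c', hc', hrel⟩ := descend hstep D c hD' h0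
  have h0' : KZ.eval c' = 0 := by
    have hr : KZ.eval (c - c') = 0 := KZ.relations_le_ker_eval_holds hrel
    rw [map_sub, h0, zero_sub, neg_eq_zero] at hr
    exact hr
  have hc'rel : c' ∈ KZ.relations := hhead c' hc' h0'
  have : c = (c - c') + c' := by abel
  rw [this]
  exact KZ.relations.add_mem hrel hc'rel

/-- **Flagged ladder step 1 (do not staff before the rung lands): `EllipticLogCell → DimOneKernel`.** -/
theorem stub_headStep : HeadStep := by
  sorry

/-- **Flagged ladder step 2 (owned by the dimension routes; beyond the method family's ceiling): `∀ d ≥ 1, GradedStep d`.** -/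
theorem stub_dimensionSteps : DimensionSteps := by
  sorry

/-- **Ladder composition to the crux BY NAME** (closed form, registered-skeleton convention; `sorry` lives only inside
the five `stub_*`): the three rung stubs give `EllipticLogCell` (`EllipticLogCell_of`, real proof), the head step gives
`DimOneKernel`, the dimension steps descend every kernel element to dimension one (`kzKernel_of_ladder`, real proof), and
`KZKernelConjecture ↔ XMapKernel` is the landed `XMapKernelIffSummit.xMapKernel_iff_kzKernelConjecture`. -/
theorem XMapKernel_of : XMapKernel :=
  XMapKernelIffSummit.xMapKernel_iff_kzKernelConjecture.mpr
    (kzKernel_of_ladder (stub_headStep ellipticLogCell_of_stubs) stub_dimensionSteps)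

end Summit.KontsevichZagierPeriods.KontsevichZagierPeriods.Cruxes.XMapKernel.EllipticLogCell
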